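import Literature.MathematicalPhysics.QuantumFieldTheory.Balaban1983to89.B2
import Literature.MathematicalPhysics.QuantumFieldTheory.Balaban1983to89.HiggsLattice
import HarnessLib

/-!
# King 1986 I, §2.3 and §3.1–§3.2 AS PRINTED: Theorem 2.1 (2.21)–(2.23), the small-field functions χ_k (3.1)–(3.2),
# Theorem 3.1 (3.3)–(3.4), Definition 3.2 (3.5), Theorem 3.3 (3.6)–(3.8), Theorem 3.4 (3.9) — and the deduction
# (3.10)–(3.13) «Hence {Z^{ε_K}(T_{ε_K}, g, h)} is a Cauchy sequence» PROVED

statement-level skeleton of published theorems with citation tags; proofs where landed; nothing here is a claim about the Yang–Mills mass gap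

C. King, *The U(1) Higgs model. I. The continuum limit*, Commun. Math. Phys. **102** (1986) 649–677 [King1986], §2.3
p. 654, §3.1 pp. 654–656, §3.2 pp. 656–657.  PDF held: `paper:king1986-cmp102-king-u1-higgs-i` (journal page = PDF page
+ 648).  Page renders read AS IMAGES for every quotation below:
`run/shared/lean/pub/pub-balaban/b2b-balaban-template/king-renders/1986-cmp102-king-u1-higgs-I-p006/p007/p008/p009-x2.png`
(pp. 654–657) and `…-p005-x2.png` (p. 653, (2.10)–(2.17)).

CITATION HEADER (lean-in-tree rule).  Typed for the cell `lit-balaban` (seat `lit-balaban-type-King86`, R141 (B): the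
King statements the ladder's node N15 and the spine crux 20042 cite) as a HYPOTHESIS-SCHEMA ∕ named-fact file in the
style of the cell's `…Statements` modules.  The tree already PROVES King's §4 (pp. 670–675: (4.1)–(4.45), Lemmas
4.1–4.5, Prop. 3.8, Prop. 3.10) at `A = 0` on the torus (`King1986/*`, 34 files) but had NO declaration for the
statements of §2.3–§3.2, although `Balaban1983to89/T3*` and `Node00/N23*` cite «Thm 3.4 (3.9) p. 656» as their template
26 times.  WHAT IS REPRODUCED, and how:
* §0 `eps L K = ε_K = L^{−K}` (p. 654) with `L^kε_K = ε_{K−k}` (`pow_mul_eps`, the identity behind p. 656 *"Since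
  L^kε_K = L^{k+n}ε_{K+n}"*), and the torus (2.21) (`Torus221`: `M`, half-sides `L_μ`, `2L_μM^{−1} ∈ ℕ`, `|T| = Π2L_μ`)
  with the printed remark *"T can be fitted exactly by … large blocks"* PROVED (`Torus221.fit_largeBlocks`).
* §1 **Theorem 2.1** (2.22)–(2.23) as `Thm21Printed` over the generating functionals `Z^{ε_K}(T_{ε_K}, g, h)` (schema).
* §2 the elementary bound *"|e^x − e^y| ≤ |x − y|(e^x + e^y)"* of p. 656 (= [King1986II] (4.8)) PROVED.
* §3 the choice **(3.12)** `k = [2βK(2β+γ)^{−1}]` and the rate **(3.13)** PROVED as real analysis (`kChoice`,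
  `exponents_at_kChoice`, `rate_at_kChoice`, `tendsto_rate313`).
* §4 **(3.1)–(3.2)** CONCRETELY on the cell's (Higgs)₂,₃ carrier `Balaban1983to89.HiggsLattice` ([Ba 1] = [Balaban1982Higgs1]
  (1.2) tori, `VecField`, `ScalarField`, `ChargeData.U`): `p(ε)` IS the tree's `Balaban1983to89.B2.pFn` (reused, `pFn_eq`),
  the four small-field inequalities `SmallField32` and `χ_k = chi32 ∈ {0, 1}`; **Definition 3.2 (3.5)** `IsRegular35`.
* §5 **Theorem 3.3** (3.6)–(3.8) with the `δC^{(k)}`, `δG_k` clauses, as the schema `Thm33Printed` over abstract kernel data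
  `Thm33Data` (the operators (2.13)–(2.16) are not constructed here; [Ba 4] = [Balaban1983RegularityDecay] proves it).
* §6 **Theorem 3.1** (3.3)–(3.4) and **Theorem 3.4** (3.9) as schemas `RGData.Thm31Printed`, `RGData.Thm34Printed` over
  abstract renormalization-group data `RGData` (configuration spaces `X m` of the unit-lattice fields `(A_k, φ_k)` indexed
  by `m = K − k`, measures `(dA_k)(dφ_k)`, `χ_k`, effective actions `S^{(k),1}`, `Z^{ε_K}`), plus the ultra-violet
  stability input of p. 657 ∕ [King1986II] (4.2) as `RGData.UVStable`.
* §7–§8 **THE PROOF OF THEOREM 2.1 (i) ON pp. 656–657, PROVED over the schema**: (3.10)–(3.11) for an arbitrary measure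
  space (`abs_sub_le_of_smallField_bounds`, `bound_311`), *"exp[−p(ε)²] ≤ ε^σ for ε small, since p ≥ 1"* in the explicit
  form `exp[−p(ε)²] ≤ ε^{b₀²}` (`exp_neg_pFn_sq_le`), the quantitative (3.13) (`RGData.cauchy_bound_313`) and *"Hence
  {Z^{ε_K}(T_{ε_K}, g, h)} is a Cauchy sequence and converges"* (`RGData.hasContinuumLimit_of_thm31_thm34`:
  `Thm31Printed ∧ Thm34Printed ∧ UVStable ⇒ HasContinuumLimit Z`).

INDEXING NOTE (§6).  King's pair `(K, k)` enters every printed quantity through `m := K − k` and `k`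
(`L^kε_K = L^{−m}`); the schema indexes the unit-lattice configuration spaces by `m`, so that `S^{(k),1}` (from `ε_K`) and
`S^{(k+n),1}` (from `ε_{K+n}`) of Theorem 3.4 live on the SAME type `X m`, as in print (*"two models on the same unit
lattice T₁^{(k)}"*).  `K ≥ J ∧ k ≤ K − J` of Theorem 3.1 reads `m ≥ J`.

HONEST SCOPE.  Theorems 2.1, 3.1, 3.3, 3.4 are HYPOTHESES (schema `def … : Prop` over abstract data); King's model-specific
objects (the U(1) Higgs measure, the effective actions (3.14), the operators (2.13)–(2.16)) are not constructed; what is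
PROVED is the real-analysis ∕ measure-theory bookkeeping King prints between them ((3.10)–(3.13), the exponential bound,
the large-block fit) and the concrete reading of (3.1)–(3.2), (3.5) on the (Higgs)₂,₃ carrier.  `d = 2, 3` and the
sources `g, h` are fixed parameters of the data, as in print.  Companion: `King1986/RotationInvarianceStatements` ([King1986II]
§2, §4) consumes §2–§3 and §7 for Theorem 2.4 there.  Nothing here bears on Bałaban's 4-d Yang–Mills papers, on infinite
volume, a mass gap, or the Clay problem; count-neutral for the ladder (no node discharged).
-/

noncomputable section

open Real Filter Topology MeasureTheory Finset

namespace Literature.MathematicalPhysics.QuantumFieldTheory.King1986.ContinuumLimit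

/-! ## §0 The lattice spacings `ε_K = L^{−K}` and the torus (2.21) -/

/-- King's lattice spacings `ε_K = L^{−K}`, `K = 0, …, ∞` (p. 654: *"We then define lattice spacings {ε_K = L^{−K}},
K = 0, …, ∞"*; [King1986II] (2.8) p. 325 is the same definition).  Also used for the running scale
`L^kε_K = L^{−(K−k)} = ε_{K−k}` (`pow_mul_eps`). [cite: King1986, (2.21) p.654] -/
def eps (L K : ℕ) : ℝ := ((L : ℝ) ^ K)⁻¹

/-- `ε_K > 0`. [cite: King1986, (2.21) p.654] -/
theorem eps_pos {L : ℕ} (hL : 0 < L) (K : ℕ) : 0 < eps L K := by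
  unfold eps
  have : (0 : ℝ) < L := by exact_mod_cast hL
  positivity

/-- `ε_0 = 1`. [cite: King1986, (2.21) p.654] -/
theorem eps_zero (L : ℕ) : eps L 0 = 1 := by simp [eps]

/-- `ε_K ≤ 1` for `L ≥ 1`. [cite: King1986, (2.21) p.654] -/
theorem eps_le_one {L : ℕ} (hL : 1 ≤ L) (K : ℕ) : eps L K ≤ 1 := by
  unfold eps
  have h1 : (1 : ℝ) ≤ (L : ℝ) ^ K := one_le_pow₀ (by exact_mod_cast hL)
  exact inv_le_one_of_one_le₀ h1

/-- `ε_K` as a real power: `ε_K = L^{−K}`. [cite: King1986, (2.21) p.654] -/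
theorem eps_eq_rpow {L : ℕ} (hL : 0 < L) (K : ℕ) : eps L K = (L : ℝ) ^ (-(K : ℝ)) := by
  have hL' : (0 : ℝ) < L := by exact_mod_cast hL
  rw [eps, Real.rpow_neg hL'.le, Real.rpow_natCast]

/-- `ε_K^s = L^{−sK}` for every real exponent `s` (the currency of (3.9)–(3.13): `(L^kε_K)^{−β}`, `(L^kε_K)^σ`).
[cite: King1986, (3.9) p.656] -/
theorem eps_rpow {L : ℕ} (hL : 0 < L) (K : ℕ) (s : ℝ) : (eps L K) ^ s = (L : ℝ) ^ (-(s * K)) := by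
  have hL' : (0 : ℝ) < L := by exact_mod_cast hL
  rw [eps_eq_rpow hL, ← Real.rpow_mul hL'.le]
  ring_nf

/-- **The running scale depends on `K − k` only**: `L^kε_K = ε_{K−k} = L^{−(K−k)}` for `k ≤ K` (p. 656: *"Since
L^kε_K = L^{k+n}ε_{K+n}, the fields A_k, φ_k have the same bounds in each integral"*). [cite: King1986, (3.10) p.656] -/
theorem pow_mul_eps {L : ℕ} (hL : 0 < L) {k K : ℕ} (hk : k ≤ K) : (L : ℝ) ^ k * eps L K = eps L (K - k) := by
  have hL' : (L : ℝ) ≠ 0 := by exact_mod_cast hL.ne'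
  unfold eps
  obtain ⟨m, rfl⟩ := Nat.exists_eq_add_of_le hk
  rw [Nat.add_sub_cancel_left, pow_add, mul_inv, ← mul_assoc, mul_inv_cancel₀ (pow_ne_zero _ hL'), one_mul]

/-- `L^{k+n}ε_{K+n} = L^kε_K` (p. 656). [cite: King1986, (3.10) p.656] -/
theorem pow_mul_eps_shift {L : ℕ} (hL : 0 < L) (k K n : ℕ) :
    (L : ℝ) ^ (k + n) * eps L (K + n) = (L : ℝ) ^ k * eps L K := by
  have hL' : (L : ℝ) ≠ 0 := by exact_mod_cast hL.ne'
  unfold eps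
  rw [pow_add, pow_add, mul_inv]
  field_simp

/-- **The torus (2.21)**, p. 654 [PDF 6], verbatim: *"We shall consider the model on a torus T defined by
T = {x ∈ R^d : −L_μ ≤ x_μ < L_μ, μ = 1, …, d}, (2.21) i.e. we use periodic boundary conditions on T. We require that
2L_μM^{−1} ∈ N, each μ = 1, …, d, where M is a large integer (this is the same integer that is specified in [Ba 4]). We
then define lattice spacings {ε_K = L^{−K}}, K = 0, …, ∞; so for each K ≥ 0, T can be fitted exactly by neighboring
disjoint blocks of M^d sites on the lattice ε_Kℤ^d (henceforth called "large blocks"). We write T_ε = T ∩ εZ^d."*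
Data: the large-block integer `M ≥ 1`, the half-sides `L_μ > 0` with `2L_μ/M ∈ ℕ`.  (For the CONCRETE lattices
`T_{ε_K}` with their fields the cell's carrier is `Balaban1983to89.HiggsLattice` — [Ba 1] (1.2) with `ε = ε_K`,
`L_μ = ML'_μ`; see `SmallField32` below.) [cite: King1986, (2.21) p.654] -/
structure Torus221 (d : ℕ) where
  /-- the large integer `M` of [Ba 4] -/
  M : ℕ
  M_pos : 0 < M
  /-- the half-sides `L_μ` -/
  side : Fin d → ℝ
  side_pos : ∀ μ, 0 < side μ
  /-- `2L_μ M^{−1} ∈ ℕ` -/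
  fit : ∀ μ, ∃ n : ℕ, 2 * side μ = n * M

namespace Torus221

variable {d : ℕ} (T : Torus221 d)

/-- The torus as the box `{x ∈ ℝ^d : −L_μ ≤ x_μ < L_μ}` (2.21) (periodic identification understood). [cite: King1986, (2.21) p.654] -/
def carrier : Set (Fin d → ℝ) := {x | ∀ μ, -T.side μ ≤ x μ ∧ x μ < T.side μ}

/-- `T_ε = T ∩ εℤ^d` (p. 654). [cite: King1986, (2.21) p.654] -/
def latticeSites (ε : ℝ) : Set (Fin d → ℝ) := {x | x ∈ T.carrier ∧ ∀ μ, ∃ n : ℤ, x μ = n * ε}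

/-- `|T| = Π_{μ=1}^{d} 2L_μ` (Theorem 2.1, p. 654). [cite: King1986, (2.23) p.654] -/
def vol : ℝ := ∏ μ, 2 * T.side μ

/-- `|T| > 0`. [cite: King1986, (2.23) p.654] -/
theorem vol_pos : 0 < T.vol := by
  unfold vol
  exact Finset.prod_pos fun μ _ => by linarith [T.side_pos μ]

/-- p. 654: *"so for each K ≥ 0, T can be fitted exactly by neighboring disjoint blocks of M^d sites on the lattice
ε_Kℤ^d"* — PROVED in the form: every side `2L_μ` is an integer multiple of the large-block side `M·ε_K`
(namely `2L_μ = (nL^K)·(Mε_K)` when `2L_μ = nM`). [cite: King1986, (2.21) p.654] -/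
theorem fit_largeBlocks {L : ℕ} (hL : 0 < L) (K : ℕ) (μ : Fin d) :
    ∃ m : ℕ, 2 * T.side μ = m * ((T.M : ℝ) * eps L K) := by
  obtain ⟨n, hn⟩ := T.fit μ
  refine ⟨n * L ^ K, ?_⟩
  have hL' : (L : ℝ) ^ K ≠ 0 := pow_ne_zero _ (by exact_mod_cast hL.ne')
  rw [hn, eps]
  push_cast
  field_simp

end Torus221

/-! ## §1 Theorem 2.1 (2.22)–(2.23) as printed (hypothesis schema) -/

/-- **THEOREM 2.1** p. 654 [PDF 6], verbatim: *"In [Ba 1–4] uniform upper and lower bounds were derived for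
Z^{ε_K}(T_{ε_K}) in d = 2, 3. We prove the existence of the continuum limit as K → ∞. **Theorem 2.1.** For the torus
T defined by (2.21) in dimensions d = 2, 3, (i) ∃ lim_{K→∞} Z^{ε_K}(T_{ε_K}, g, h) = Z(T, g, h), (2.22) (ii)
|ln Z(T, g, h)| ≤ C|T|, (2.23) where C depends on g, h and |T| = Π_{μ=1}^{d} 2L_μ."*  HYPOTHESIS SCHEMA over the
generating functionals `Z T K = Z^{ε_K}(T_{ε_K}, g, h)` of the lattice U(1) Higgs model of §2.1 (sources `g, h` fixed;
they are NOT constructed here): (i) the limit exists for every torus (2.21), (ii) with ONE constant `C` for all tori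
(«C depends on g, h» only).  `0 < Z(T, g, h)` is implicit in print (its logarithm is taken) and explicit here.  The
deduction (i) ⇐ Theorem 3.1 ∧ Theorem 3.4 of pp. 656–657 is PROVED below (`exists_limit_of_thm31_thm34`); this `def`
is the printed claim itself, a hypothesis for consumers. [cite: King1986, Thm 2.1 (2.22)–(2.23) p.654] -/
def Thm21Printed {d : ℕ} (Z : Torus221 d → ℕ → ℝ) : Prop :=
  ∃ C : ℝ, ∀ T : Torus221 d, ∃ Zlim : ℝ, 0 < Zlim ∧ Tendsto (Z T) atTop (𝓝 Zlim) ∧ |Real.log Zlim| ≤ C * T.vol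

/-- Theorem 2.1 (i) alone, for ONE torus: the sequence `K ↦ Z^{ε_K}(T_{ε_K}, g, h)` converges. [cite: King1986, Thm 2.1 (2.22) p.654] -/
def HasContinuumLimit (Z : ℕ → ℝ) : Prop := ∃ Zlim : ℝ, Tendsto Z atTop (𝓝 Zlim)

/-- Unfolding: Theorem 2.1 gives (i) for each torus. [cite: King1986, Thm 2.1 (2.22) p.654] -/
theorem Thm21Printed.hasContinuumLimit {d : ℕ} {Z : Torus221 d → ℕ → ℝ} (h : Thm21Printed Z) (T : Torus221 d) :
    HasContinuumLimit (Z T) := by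
  obtain ⟨_, hC⟩ := h
  obtain ⟨Zlim, _, hlim, _⟩ := hC T
  exact ⟨Zlim, hlim⟩

/-! ## §2 The elementary exponential bound of p. 656 and p. 337 of [King1986II] -/

/-- p. 656 [PDF 8]: *"Using Theorem 3.4 and the bound |e^x − e^y| ≤ |x − y|(e^x + e^y)"*; [King1986II] (4.8) p. 337:
*"e^x − e^y ≤ |e^x − e^y| ≤ |x − y|(e^x + e^y)"*.  PROVED (convexity: `e^y ≥ e^x(1 + (y − x))`). [cite: King1986, (3.11) p.656] -/
theorem abs_exp_sub_exp_le (x y : ℝ) : |exp x - exp y| ≤ |x - y| * (exp x + exp y) := by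
  have key : ∀ a b : ℝ, exp a - exp b ≤ |a - b| * (exp a + exp b) := by
    intro a b
    have h1 : (b - a) + 1 ≤ exp (b - a) := add_one_le_exp (b - a)
    have h2 : exp b = exp a * exp (b - a) := by rw [← exp_add]; ring_nf
    have ha : 0 < exp a := exp_pos a
    have hb : 0 < exp b := exp_pos b
    have h3 : exp a * ((b - a) + 1) ≤ exp a * exp (b - a) := mul_le_mul_of_nonneg_left h1 ha.le
    have h4 : exp a * (a - b) ≤ exp a * |a - b| := mul_le_mul_of_nonneg_left (le_abs_self _) ha.le
    have h5 : 0 ≤ |a - b| * exp b := mul_nonneg (abs_nonneg _) hb.le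
    nlinarith
  rw [abs_le]
  refine ⟨?_, key x y⟩
  have := key y x
  rw [abs_sub_comm] at this
  linarith

/-- The first inequality of [King1986II] (4.8): `e^x − e^y ≤ |e^x − e^y|`. [cite: King1986II, (4.8) p.337] -/
theorem exp_sub_exp_le_abs (x y : ℝ) : exp x - exp y ≤ |exp x - exp y| := le_abs_self _

/-! ## §3 The choice of `k` (3.12) and the rate (3.13) — PROVED -/

/-- **(3.12)** p. 657 [PDF 9], verbatim: *"Of course we are free to choose k as we like. To show that (3.11) vanishes
as K → ∞, we can take k = [2βK(2β + γ)^{−1}], (3.12)"*. [cite: King1986, (3.12) p.657] -/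
def kChoice (β γ : ℝ) (K : ℕ) : ℕ := ⌊2 * β * K / (2 * β + γ)⌋₊

/-- `k ≤ K` for the choice (3.12) (`2β/(2β+γ) < 1`). [cite: King1986, (3.12) p.657] -/
theorem kChoice_le {β γ : ℝ} (hβ : 0 < β) (hγ : 0 < γ) (K : ℕ) : kChoice β γ K ≤ K := by
  unfold kChoice
  have hden : 0 < 2 * β + γ := by linarith
  have hle : 2 * β * K / (2 * β + γ) ≤ K := by
    rw [div_le_iff₀ hden]
    have : (0 : ℝ) ≤ K := Nat.cast_nonneg K
    nlinarith
  exact_mod_cast (Nat.floor_le_of_le (by exact_mod_cast hle) : ⌊2 * β * K / (2 * β + γ)⌋₊ ≤ K)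

/-- The two exponent estimates behind (3.13): for `k = [2βK/(2β+γ)]`,
`−γk + β(K − k) ≤ −βγK/(2β+γ) + (β + γ)` and `−σ(K − k) ≤ −σγK/(2β+γ)`. [cite: King1986, (3.13) p.657] -/
theorem exponents_at_kChoice {β γ σ : ℝ} (hβ : 0 < β) (hγ : 0 < γ) (hσ : 0 < σ) (K : ℕ) :
    -(γ * kChoice β γ K) + β * ((K : ℝ) - kChoice β γ K) ≤ -(β * γ / (2 * β + γ) * K) + (β + γ) ∧
      -(σ * ((K : ℝ) - kChoice β γ K)) ≤ -(σ * γ / (2 * β + γ) * K) := by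
  have hden : 0 < 2 * β + γ := by linarith
  set c : ℝ := 2 * β * K / (2 * β + γ) with hc
  have hc0 : 0 ≤ c := by rw [hc]; positivity
  have hk1 : (kChoice β γ K : ℝ) ≤ c := Nat.floor_le hc0
  have hk2 : c < (kChoice β γ K : ℝ) + 1 := Nat.lt_floor_add_one c
  have hcK : c * (2 * β + γ) = 2 * β * K := by rw [hc]; field_simp
  constructor
  · -- βK − (β+γ)k ≤ βK − (β+γ)(c − 1)
    have h1 : -(γ * (kChoice β γ K : ℝ)) + β * ((K : ℝ) - kChoice β γ K)
        ≤ β * K - (β + γ) * (c - 1) := by nlinarith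
    have h2 : β * K - (β + γ) * (c - 1) = -(β * γ / (2 * β + γ) * K) + (β + γ) := by
      field_simp
      nlinarith [hcK]
    linarith [h1, h2.le]
  · have h1 : -(σ * ((K : ℝ) - kChoice β γ K)) ≤ -(σ * ((K : ℝ) - c)) := by nlinarith
    have h2 : (K : ℝ) - c = γ / (2 * β + γ) * K := by
      field_simp
      nlinarith [hcK]
    rw [h2] at h1
    have h3 : σ * (γ / (2 * β + γ) * K) = σ * γ / (2 * β + γ) * K := by ring
    linarith

/-- **(3.13)** p. 657 [PDF 9]: with `k = [2βK(2β+γ)^{−1}]`, *"(3.11) ≤ C(L^{−βγK/2β+γ} + L^{−σγK/2β+γ})e^{C|T|}. (3.13)"* —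
the rate `L^{−γk}(L^kε_K)^{−β} + (L^kε_K)^σ` of (3.9)/(3.11) at this `k` is at most
`L^{β+γ}·(L^{−βγK/(2β+γ)} + L^{−σγK/(2β+γ)})` (King's generic `C` absorbs `L^{β+γ}`).  Here `L^kε_K = L^{−(K−k)}`
(`pow_mul_eps`). [cite: King1986, (3.13) p.657] -/
theorem rate_at_kChoice {L : ℝ} (hL : 1 < L) {β γ σ : ℝ} (hβ : 0 < β) (hγ : 0 < γ) (hσ : 0 < σ) (K : ℕ) :
    L ^ (-(γ * kChoice β γ K)) * L ^ (β * ((K : ℝ) - kChoice β γ K)) + L ^ (-(σ * ((K : ℝ) - kChoice β γ K)))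
      ≤ L ^ (β + γ) * (L ^ (-(β * γ / (2 * β + γ) * K)) + L ^ (-(σ * γ / (2 * β + γ) * K))) := by
  have hL0 : 0 < L := by linarith
  have hL1 : 1 ≤ L := hL.le
  obtain ⟨h1, h2⟩ := exponents_at_kChoice (σ := σ) hβ hγ hσ K
  rw [← Real.rpow_add hL0, mul_add, ← Real.rpow_add hL0]
  have hA : L ^ (-(γ * (kChoice β γ K : ℝ)) + β * ((K : ℝ) - kChoice β γ K))
      ≤ L ^ (β + γ + -(β * γ / (2 * β + γ) * K)) :=
    Real.rpow_le_rpow_of_exponent_le hL1 (by linarith)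
  have hB : L ^ (-(σ * ((K : ℝ) - kChoice β γ K))) ≤ L ^ (-(σ * γ / (2 * β + γ) * K)) :=
    Real.rpow_le_rpow_of_exponent_le hL1 h2
  have hB' : L ^ (-(σ * γ / (2 * β + γ) * K)) ≤ L ^ (β + γ) * L ^ (-(σ * γ / (2 * β + γ) * K)) := by
    have h1le : 1 ≤ L ^ (β + γ) := Real.one_le_rpow hL1 (by linarith)
    have hpos : 0 ≤ L ^ (-(σ * γ / (2 * β + γ) * K)) := Real.rpow_nonneg hL0.le _
    nlinarith
  linarith

/-- The rate (3.13) as GEOMETRIC sequences in `K`: `L^{−aK} = (L^{−a})^K` with ratio `L^{−a} < 1` for `a > 0`, `L > 1`.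
[cite: King1986, (3.13) p.657] -/
theorem rpow_neg_mul_natCast {L : ℝ} (hL : 0 < L) (a : ℝ) (K : ℕ) : L ^ (-(a * K)) = (L ^ (-a)) ^ K := by
  rw [← Real.rpow_natCast, ← Real.rpow_mul hL.le]
  ring_nf

/-- `0 ≤ L^{−a} < 1` for `L > 1`, `a > 0`. [cite: King1986, (3.13) p.657] -/
theorem rpow_neg_lt_one {L : ℝ} (hL : 1 < L) {a : ℝ} (ha : 0 < a) : 0 ≤ L ^ (-a) ∧ L ^ (-a) < 1 :=
  ⟨Real.rpow_nonneg (by linarith) _, Real.rpow_lt_one_of_one_lt_of_neg hL (by linarith)⟩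

/-- p. 657: *"(3.11) vanishes as K → ∞"* — the right side of (3.13) tends to `0`. [cite: King1986, (3.13) p.657] -/
theorem tendsto_rate313 {L : ℝ} (hL : 1 < L) {β γ σ : ℝ} (hβ : 0 < β) (hγ : 0 < γ) (hσ : 0 < σ) (A : ℝ) :
    Tendsto (fun K : ℕ => A * (L ^ (-(β * γ / (2 * β + γ) * K)) + L ^ (-(σ * γ / (2 * β + γ) * K))))
      atTop (𝓝 0) := by
  have hL0 : 0 < L := by linarith
  have hden : 0 < 2 * β + γ := by linarith
  have ha : 0 < β * γ / (2 * β + γ) := by positivity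
  have hb : 0 < σ * γ / (2 * β + γ) := by positivity
  have h1 : Tendsto (fun K : ℕ => (L ^ (-(β * γ / (2 * β + γ)))) ^ K) atTop (𝓝 0) :=
    tendsto_pow_atTop_nhds_zero_of_lt_one (rpow_neg_lt_one hL ha).1 (rpow_neg_lt_one hL ha).2
  have h2 : Tendsto (fun K : ℕ => (L ^ (-(σ * γ / (2 * β + γ)))) ^ K) atTop (𝓝 0) :=
    tendsto_pow_atTop_nhds_zero_of_lt_one (rpow_neg_lt_one hL hb).1 (rpow_neg_lt_one hL hb).2
  have h := (h1.add h2).const_mul A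
  simp only [add_zero, mul_zero] at h
  refine h.congr' (Eventually.of_forall fun K => ?_)
  simp only [rpow_neg_mul_natCast hL0]

/-! ## §4 The small-field functions `χ_k` (3.1)–(3.2), CONCRETELY on the (Higgs)₂,₃ carrier `Balaban1983to89.HiggsLattice` -/

section SmallField

open Literature.MathematicalPhysics.QuantumFieldTheory.Balaban1983to89.HiggsLattice

/-- **(3.1)** p. 655 [PDF 7], verbatim: *"We use the following quantity to define "large" and "small" fields:
p(ε) = b₀(1 + log ε^{−1})^p, (3.1) where p is a small integer and b₀ is a constant O(1)."*  This IS the function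
`p(ε)` of [Ba 1–2] already in the tree as `Balaban1983to89.B2.pFn b₀ p ε = b₀(1 + log ε⁻¹)^p` (real exponent), which
is REUSED, not re-declared; this lemma only records the identification. [cite: King1986, (3.1) p.655] -/
theorem pFn_eq (b₀ p ε : ℝ) : Balaban1983to89.B2.pFn b₀ p ε = b₀ * (1 + Real.log ε⁻¹) ^ p := rfl

variable {N : ℕ}

/-- **(3.2)** p. 655 [PDF 7], verbatim: *"After rescaling to the unit lattice T₁^{(k)}, the effective action is written
S^{(k),1}(T₁^{(k)}, A_k, φ_k, g, h) with A_k, φ_k unit lattice fields. Let us denote by χ_k(A_k, φ_k) the function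
which is one when all the following inequalities hold and zero otherwise:
|A_{k,μ}(y)| ≤ p(L^{k−1}ε)(μ₀L^{k−1}ε)^{−1}, |∂A_{k,μ}(b)| ≤ p(L^{k−1}ε), |φ_k(y)| ≤ p(L^{k−1}ε)[λ(L^{k−1}ε)^{4−d}]^{−1/4},
|D_{A_k}φ_k(b)| ≤ p(L^{k−1}ε), (3.2) for all y, b and μ, and where D_{A_k}φ_k(b) = exp[e(L^kε)^{2−d/2}qA_k(b)]φ_k(b₊) −
φ_k(b₋)."*  TYPED CONCRETELY on the cell's (Higgs)₂,₃ carrier ([Ba 1] (1.2) = `HiggsLattice.Params` with `ε = ε_K`):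
the unit-lattice fields at step `k` are functions on the bonds ∕ sites of `T^{(k)}` (`VecField P k`, `ScalarField P k N`),
`L^kε = P.mesh k`, `L^{k−1}ε = P.mesh k / L`, `p(·) = B2.pFn b₀ p ·`, the unit-lattice difference
`∂A_{k,μ}(⟨y, y+e_ν⟩) = A_{k,μ}(y + e_ν) − A_{k,μ}(y)`, and `exp[e(L^kε)^{2−d/2}qA] = ChargeData.U ((L^kε)^{2−d/2}) A`
(`= exp(((L^kε)^{2−d/2}·e·A)•q)`, [Ba 1] p. 605).  The four printed inequalities, as a `Prop`. [cite: King1986, (3.2) p.655] -/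
def SmallField32 (C : ChargeData N) (b₀ p μ₀ lam : ℝ) (P : Params) (k : ℕ)
    (A : VecField P k) (φ : ScalarField P k N) : Prop :=
  (∀ b : PBond P k,
      |A b| ≤ Balaban1983to89.B2.pFn b₀ p (P.mesh k / P.L) * (μ₀ * (P.mesh k / P.L))⁻¹) ∧
  (∀ (b : PBond P k) (ν : Fin P.d),
      |A ⟨b.src.shift ν, b.dir⟩ - A b| ≤ Balaban1983to89.B2.pFn b₀ p (P.mesh k / P.L)) ∧
  (∀ y : Site P k,
      ‖φ y‖ ≤ Balaban1983to89.B2.pFn b₀ p (P.mesh k / P.L)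
        * (lam * (P.mesh k / P.L) ^ (4 - (P.d : ℝ))) ^ (-(1 / 4 : ℝ))) ∧
  (∀ b : PBond P k,
      ‖C.U ((P.mesh k) ^ (2 - (P.d : ℝ) / 2)) (A b) (φ b.tgt) - φ b.src‖
        ≤ Balaban1983to89.B2.pFn b₀ p (P.mesh k / P.L))

open Classical in
/-- `χ_k(A_k, φ_k)` — *"the function which is one when all the following inequalities hold and zero otherwise"* (3.2).
[cite: King1986, (3.2) p.655] -/
def chi32 (C : ChargeData N) (b₀ p μ₀ lam : ℝ) (P : Params) (k : ℕ)
    (A : VecField P k) (φ : ScalarField P k N) : ℝ :=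
  if SmallField32 C b₀ p μ₀ lam P k A φ then 1 else 0

/-- `χ_k` takes the values `0` and `1` only. [cite: King1986, (3.2) p.655] -/
theorem chi32_eq_zero_or_one (C : ChargeData N) (b₀ p μ₀ lam : ℝ) (P : Params) (k : ℕ)
    (A : VecField P k) (φ : ScalarField P k N) :
    chi32 C b₀ p μ₀ lam P k A φ = 0 ∨ chi32 C b₀ p μ₀ lam P k A φ = 1 := by
  unfold chi32
  split_ifs
  · exact Or.inr rfl
  · exact Or.inl rfl

/-- `χ_k = 1` exactly on the small-field configurations (3.2). [cite: King1986, (3.2) p.655] -/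
theorem chi32_eq_one_iff (C : ChargeData N) (b₀ p μ₀ lam : ℝ) (P : Params) (k : ℕ)
    (A : VecField P k) (φ : ScalarField P k N) :
    chi32 C b₀ p μ₀ lam P k A φ = 1 ↔ SmallField32 C b₀ p μ₀ lam P k A φ := by
  unfold chi32
  split_ifs with h
  · simp [h]
  · simp [h]

/-- **DEFINITION 3.2 (3.5)** p. 655 [PDF 7], verbatim: *"Let A be a vector field configuration on Ω_η, where
Ω^{(k)} ⊂ T₁^{(k)} is a union of large blocks and η = L^{−k}. Then A is regular on Ω_η if |∂^η_μ A_ν(x)| ≤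
C(e(L^kε)^{2−d/2})^{β−1} (3.5) for all x ∈ Ω_η, μ, ν = 1, …, d and some β > 0 (e is the electric charge)."*  TYPED on the
carrier: the fine field is a bond function on the lattice `T^{(j)}` (any level `j`; King's `Ω_η` is the fine lattice
rescaled to spacing `η = L^{−k}`), `Ω` a set of sites, `∂^η_μ A_ν(x) = η^{−1}(A_ν(x + ηe_μ) − A_ν(x))` with the
spacing `η` an explicit argument, and the right side with explicit `C, e, L^kε, β`. [cite: King1986, Def. 3.2 (3.5) p.655] -/
def IsRegular35 (P : Params) (j : ℕ) (Ω : Set (Site P j)) (η C e s β : ℝ) (A : VecField P j) : Prop :=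
  ∀ x ∈ Ω, ∀ μ ν : Fin P.d,
    |η⁻¹ * (A ⟨x.shift μ, ν⟩ - A ⟨x, ν⟩)| ≤ C * (e * s ^ (2 - (P.d : ℝ) / 2)) ^ (β - 1)

end SmallField

/-! ## §5 Theorem 3.3 (3.6)–(3.8) as printed — the decay shapes (hypothesis schema over abstract kernels) -/

section Thm33

variable {S : Type*} {E : Type*} [NormedAddCommGroup E] [NormedSpace ℝ E]

/-- The shape **(3.6)** p. 656 [PDF 8]: *"|Δ^{(k)}(Ω, A)(x, y)|, |C^{(k)}(Ω, A)(x, y)| ≤ C exp[−δ₀|x − y|], (3.6)"* for a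
kernel `κ(x, y)` on the unit lattice `Ω^{(k)}` with distance `|x − y|`. [cite: King1986, Thm 3.3 (3.6) p.656] -/
def Decay36 (dist : S → S → ℝ) (C δ₀ : ℝ) (κ : S → S → ℝ) : Prop :=
  ∀ x y, |κ x y| ≤ C * Real.exp (-(δ₀ * dist x y))

/-- The shape **(3.7)** p. 656 [PDF 8]: *"|G_k(Ω, A)f(x)|, |D^η_{A,μ}G_k(Ω, A)f(x)| ≤ C exp[−δ₀ dist(x, supp f)] ‖f‖, (3.7)"*
for an operator `G` on functions `f : Ω_η → ℝ^N`, with `dist(x, supp f)` and the sup norm `‖f‖` supplied as data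
(`dsupp f x`, `supNorm f`). [cite: King1986, Thm 3.3 (3.7) p.656] -/
def Decay37 (dsupp : (S → E) → S → ℝ) (supNorm : (S → E) → ℝ) (C δ₀ : ℝ) (G : (S → E) → (S → E)) : Prop :=
  ∀ f x, ‖G f x‖ ≤ C * Real.exp (-(δ₀ * dsupp f x)) * supNorm f

/-- The shape **(3.8)** p. 656 [PDF 8]: *"(1/|x − y|^α)|U(A(Γ_{y,x}))D^η_{A,μ}G_k(Ω, A)f(x) − D^η_{A,μ}G_k(Ω, A)f(y)| ≤
C exp[−δ₀ dist({x, y}, supp f)] ‖f‖. (3.8)"* — the Hölder quotient of an operator `D` with the parallel transport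
`U(A(Γ_{y,x}))` (`transport y x`), for `x ≠ y`. [cite: King1986, Thm 3.3 (3.8) p.656] -/
def Holder38 (dist : S → S → ℝ) (dsupp2 : (S → E) → S → S → ℝ) (supNorm : (S → E) → ℝ)
    (transport : S → S → (E →L[ℝ] E)) (α C δ₀ : ℝ) (D : (S → E) → (S → E)) : Prop :=
  ∀ f x y, x ≠ y →
    (dist x y) ^ (-α) * ‖transport y x (D f x) - D f y‖ ≤ C * Real.exp (-(δ₀ * dsupp2 f x y)) * supNorm f

/-- The data Theorem 3.3 speaks about, for ONE regular background `A` on `Ω_η` (Definition 3.2) and one `k ≤ K`: the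
unit lattice `Ω^{(k)}` (`Sk`) with its distance, the `η`-lattice `Ω_η` (`Sη`) with distance, distance to `supp f`,
to `∂Ω` (*"that part of the boundary of Ω which does not belong to ∂T_η"*, cf. [King1986II] p. 338), the sup norm, the
parallel transports `U(A(Γ_{y,x}))`, and the printed operators: `Δ^{(k)}(Ω, A)`, `C^{(k)}(Ω, A)` (kernels on `Ω^{(k)}`),
`G_k(Ω, A)`, `D^η_{A,μ}G_k(Ω, A)` (`μ = 1, …, d`) on `f : Ω_η → ℝ^N`, and the differences `δC^{(k)}(Ω, A) =
C^{(k)}(Ω, A) − C^{(k)}(A)`, `δG_k(Ω, A) = G_k(Ω, A) − G_k(A)` (and its covariant derivatives) of p. 656.  Abstract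
schema: none of these operators is constructed here ((2.13)–(2.16) p. 653 define them). [cite: King1986, Thm 3.3 p.655–656] -/
structure Thm33Data (d : ℕ) (Sk Sη E : Type*) [NormedAddCommGroup E] [NormedSpace ℝ E] where
  /-- `|x − y|` on `Ω^{(k)}` -/
  distk : Sk → Sk → ℝ
  /-- `|x − y|` on `Ω_η` -/
  distη : Sη → Sη → ℝ
  /-- `dist(x, supp f)` -/
  dsupp : (Sη → E) → Sη → ℝ
  /-- `dist({x, y}, supp f)` -/
  dsupp2 : (Sη → E) → Sη → Sη → ℝ
  /-- `dist({x, y}, ∂Ω)` on `Ω^{(k)}` resp. `Ω_η` -/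
  dbdryk : Sk → Sk → ℝ
  dbdryη : Sη → Sη → ℝ
  /-- `dist(supp f, ∂Ω)` -/
  dsuppbdry : (Sη → E) → ℝ
  /-- `‖f‖` (sup norm) -/
  supNorm : (Sη → E) → ℝ
  /-- `U(A(Γ_{y,x}))` -/
  transport : Sη → Sη → (E →L[ℝ] E)
  /-- `Δ^{(k)}(Ω, A)(x, y)` and `C^{(k)}(Ω, A)(x, y)` -/
  lapK : Sk → Sk → ℝ
  covK : Sk → Sk → ℝ
  /-- `δC^{(k)}(Ω, A)(x, y)` -/
  δcovK : Sk → Sk → ℝ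
  /-- `G_k(Ω, A)` and `D^η_{A,μ}G_k(Ω, A)` -/
  G : (Sη → E) → (Sη → E)
  DG : Fin d → (Sη → E) → (Sη → E)
  /-- `δG_k(Ω, A)` and `D^η_{A,μ}δG_k(Ω, A)` -/
  δG : (Sη → E) → (Sη → E)
  δDG : Fin d → (Sη → E) → (Sη → E)

/-- **THEOREM 3.3** pp. 655–656 [PDF 7–8], verbatim: *"Let A be regular on Ω_η, with η = L^{−k}, and let Ω^{(k)} be a
rectangular parallelepiped which is a union of large blocks on T₁^{(k)}. Then for all k ≤ K, some δ₀ > 0, 0 < α < 1, and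
for f : Ω_η → R^N, [(3.6), (3.7), (3.8)]. Finally, define δC^{(k)}(Ω, A) = C^{(k)}(Ω, A) − C^{(k)}(A) and δG_k(Ω, A) =
G_k(Ω, A) − G_k(A); then for x, y ∈ Ω_η, δC^{(k)}(Ω, A) and δG_k(Ω, A) satisfy the bounds (3.6) and (3.7)–(3.8)
respectively, with the additional factors exp[−δ₀ dist({x, y}, ∂Ω)] and exp[−δ₀ dist({x, y}, ∂Ω) − δ₀ dist(supp f, ∂Ω)]
respectively on the right-hand sides. Theorem 3.3 is proved in [Ba 4]. It implies the same bounds for the vector field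
operators (of course with A = 0)."*  HYPOTHESIS SCHEMA over `Thm33Data` (one regular `A`, one `k ≤ K`): the constants
`δ₀ > 0`, `0 < α < 1`, `C` and the nine printed bounds.  [Ba 4] = [Balaban1983RegularityDecay], whose theorems the cell
types under `Balaban1983to89.B4*`; nothing of it is asserted here. [cite: King1986, Thm 3.3 (3.6)–(3.8) p.656] -/
def Thm33Printed {d : ℕ} {Sk Sη E : Type*} [NormedAddCommGroup E] [NormedSpace ℝ E]
    (D : Thm33Data d Sk Sη E) : Prop :=
  ∃ δ₀ α C : ℝ, 0 < δ₀ ∧ 0 < α ∧ α < 1 ∧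
    -- (3.6)
    Decay36 D.distk C δ₀ D.lapK ∧ Decay36 D.distk C δ₀ D.covK ∧
    -- (3.7)
    Decay37 D.dsupp D.supNorm C δ₀ D.G ∧ (∀ μ, Decay37 D.dsupp D.supNorm C δ₀ (D.DG μ)) ∧
    -- (3.8)
    (∀ μ, Holder38 D.distη D.dsupp2 D.supNorm D.transport α C δ₀ (D.DG μ)) ∧
    -- the `δ`-operators with the additional factors
    (∀ x y, |D.δcovK x y| ≤ C * Real.exp (-(δ₀ * D.distk x y)) * Real.exp (-(δ₀ * D.dbdryk x y))) ∧
    (∀ f x, ‖D.δG f x‖ ≤ C * Real.exp (-(δ₀ * D.dsupp f x)) * D.supNorm f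
        * Real.exp (-(δ₀ * D.dbdryη x x) - δ₀ * D.dsuppbdry f)) ∧
    (∀ μ f x, ‖D.δDG μ f x‖ ≤ C * Real.exp (-(δ₀ * D.dsupp f x)) * D.supNorm f
        * Real.exp (-(δ₀ * D.dbdryη x x) - δ₀ * D.dsuppbdry f)) ∧
    (∀ μ f x y, x ≠ y → (D.distη x y) ^ (-α) * ‖D.transport y x (D.δDG μ f x) - D.δDG μ f y‖
        ≤ C * Real.exp (-(δ₀ * D.dsupp2 f x y)) * D.supNorm f
          * Real.exp (-(δ₀ * D.dbdryη x y) - δ₀ * D.dsuppbdry f))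

end Thm33

/-! ## §6 Theorems 3.1 and 3.4 as printed (hypothesis schema over the renormalization-group data) -/

/-- The data Theorems 3.1 and 3.4 speak about, for ONE torus `T` (2.21) and fixed sources `g, h`.  INDEXING: King's
running scale after `k` block-spin steps started from spacing `ε_K` is `L^kε_K = L^{−(K−k)}`; everything printed
depends on the pair `(K, k)` through `m := K − k` (the number of scales still to be integrated: *"Since
L^kε_K = L^{k+n}ε_{K+n}, the fields A_k, φ_k have the same bounds in each integral"*, p. 656) and `k`.  So: `X m` =
the space of unit-lattice field configurations `(A_k, φ_k)` on `T₁^{(k)}` when `L^kε_K = L^{−m}` (for the torus (2.21)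
this lattice has `2L_μL^m` sites per direction), `μ m` = the Lebesgue measure `(dA_k)(dφ_k)`, `chi m` = the
small-field function `χ_k` of (3.2) (its thresholds are functions of `L^{k−1}ε = L^{−m−1}`; CONCRETELY `chi32`),
`S m k` = the effective action `S^{(k),1}(T₁^{(k)}, ·, g, h)` obtained from `Z^{ε_{m+k}}` by `k` steps ((3.14) p. 657),
`Z K = Z^{ε_K}(T_{ε_K}, g, h)`, `vol = |T|`, `L` the block size, `b₀, p` the constants of `p(ε)` (3.1).  Abstract
schema: the effective actions are NOT constructed here. [cite: King1986, Thm 3.1 p.655, Thm 3.4 p.656] -/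
structure RGData (X : ℕ → Type*) [∀ m, MeasurableSpace (X m)] where
  /-- the block size `L` -/
  L : ℕ
  /-- `|T| = Π 2L_μ` -/
  vol : ℝ
  /-- the constants `b₀`, `p` of `p(ε) = b₀(1 + log ε⁻¹)^p` (3.1) -/
  b₀ : ℝ
  p : ℝ
  /-- `(dA_k)(dφ_k)` on `X m` -/
  μ : ∀ m, Measure (X m)
  /-- `χ_k(A_k, φ_k)` of (3.2) on `X m` -/
  chi : ∀ m, X m → ℝ
  /-- `S m k = S^{(k),1}(T₁^{(k)}, A_k, φ_k, g, h)` from `Z^{ε_{m+k}}` -/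
  S : ∀ m, ℕ → X m → ℝ
  /-- `Z K = Z^{ε_K}(T_{ε_K}, g, h)` -/
  Z : ℕ → ℝ

namespace RGData

variable {X : ℕ → Type*} [∀ m, MeasurableSpace (X m)]

/-- The small-field integral of (3.3)–(3.4): `∫(dA_k)(dφ_k)χ_k(A_k, φ_k) exp[−S^{(k),1}(T₁^{(k)}, A_k, φ_k, g, h) +
C(L^kε_K)^σ|T|]` for `K = m + k` (`L^kε_K = ε_m = L^{−m}`). [cite: King1986, Thm 3.1 (3.3) p.655] -/
def smallFieldIntegral (D : RGData X) (C σ : ℝ) (m k : ℕ) : ℝ :=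
  ∫ x, D.chi m x * Real.exp (-(D.S m k x) + C * (eps D.L m) ^ σ * D.vol) ∂(D.μ m)

/-- The large-field remainder of (3.4): `exp[−p(L^kε_K)² + C|T|]`. [cite: King1986, Thm 3.1 (3.4) p.655] -/
def largeFieldRemainder (D : RGData X) (C : ℝ) (m : ℕ) : ℝ :=
  Real.exp (-(Balaban1983to89.B2.pFn D.b₀ D.p (eps D.L m)) ^ 2 + C * D.vol)

/-- **THEOREM 3.1** p. 655 [PDF 7], verbatim: *"We can now formulate the basic results of the papers [Ba 1–2].
**Theorem 3.1.** Let T be defined by (2.28) [sic; (2.21)] in dimension d = 2, 3. Then for some fixed integer J, for all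
K ≥ J, and all k ≤ K − J, and for some σ > 0,
Z^{ε_K}(T_{ε_K}, g, h) ≥ ∫(dA_k)(dφ_k)χ_k(A_k, φ_k) exp[−S^{(k),1}(T₁^{(k)}, A_k, φ_k, g, h) + C(L^kε_K)^σ|T|], (3.3)
Z^{ε_K}(T_{ε_K}, g, h) ≤ ∫(dA_k)(dφ_k)χ_k(A_k, φ_k) exp[−S^{(k),1}(T₁^{(k)}, A_k, φ_k, g, h) + C(L^kε_K)^σ|T|] +
exp[−p(L^kε_K)² + C|T|]. (3.4) Once again, C depends on g, h and |T| = Π_{μ=1}^{d} 2L_μ. … The reader is referred to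
[Ba 1–4] for the proof of Theorem 3.1."*  In the `(m, k)` indexing (`K = m + k`, so «K ≥ J and k ≤ K − J» is `m ≥ J`).
HYPOTHESIS SCHEMA ([Ba 1–2] = [Balaban1982Higgs1], [Balaban1982Higgs2]; the sign of the correction `+C(L^kε_K)^σ|T|`
inside BOTH exponentials is as printed). [cite: King1986, Thm 3.1 (3.3)–(3.4) p.655] -/
def Thm31Printed (D : RGData X) : Prop :=
  ∃ J : ℕ, ∃ σ C : ℝ, 0 < σ ∧ ∀ m k : ℕ, J ≤ m →
    D.smallFieldIntegral C σ m k ≤ D.Z (m + k) ∧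
      D.Z (m + k) ≤ D.smallFieldIntegral C σ m k + D.largeFieldRemainder C m

/-- **THEOREM 3.4** p. 656 [PDF 8], verbatim: *"Consider the model defined on the lattices T_{ε_K} and T_{ε_{K+n}} for
some integer n. Then by applying the renormalization transformation k and k + n times respectively we generate two
models on the same unit lattice T₁^{(k)}, with effective actions S^{(k),1} and S^{(k+n),1}. The following theorem is the
core of this paper. **Theorem 3.4.** χ_k(A_k, φ_k)|S^{(k),1}(T₁^{(k)}, A_k, φ_k, g, h) − S^{(k+n),1}(T₁^{(k)}, A_k, φ_k, g,
h)| ≤ C(L^{−γk}(L^kε_K)^{−β} + (L^kε_K)^σ)|T|, (3.9) where 0 < γ < 1, 0 < σ, β and C depends on g, h."*  In the `(m, k)`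
indexing both actions live on `X m` (`L^kε_K = L^{k+n}ε_{K+n} = L^{−m}`): `S m k` and `S m (k + n)`.  HYPOTHESIS SCHEMA.
[cite: King1986, Thm 3.4 (3.9) p.656] -/
def Thm34Printed (D : RGData X) : Prop :=
  ∃ γ σ β C : ℝ, 0 < γ ∧ γ < 1 ∧ 0 < σ ∧ 0 < β ∧ ∀ (m k n : ℕ) (x : X m),
    D.chi m x * |D.S m k x - D.S m (k + n) x|
      ≤ C * ((D.L : ℝ) ^ (-(γ * k)) * (eps D.L m) ^ (-β) + (eps D.L m) ^ σ) * D.vol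

/-- The ultra-violet stability bound used on p. 657 (*"where we have used the ultra-violet stability bound"*) and
p. 654 (*"In [Ba 1–4] uniform upper and lower bounds were derived for Z^{ε_K}(T_{ε_K}) in d = 2, 3"*), in the explicit
form [King1986II] prints as (4.2) p. 336: `e^{−C₁|T|} ≤ Z^{ε_K}(T_{ε_K}, g, h) ≤ e^{C₂|T|}`, `C₁, C₂` independent of `K`.
HYPOTHESIS SCHEMA (input from [Ba 1–4]). [cite: King1986, p.657; King1986II, (4.2) p.336] -/
def UVStable (D : RGData X) : Prop :=
  ∃ C₁ C₂ : ℝ, ∀ K : ℕ, Real.exp (-(C₁ * D.vol)) ≤ D.Z K ∧ D.Z K ≤ Real.exp (C₂ * D.vol)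

end RGData

/-! ## §7 (3.10)–(3.11) PROVED: the two-sided small-field bounds and Theorem 3.4 control `|Z^{ε_K} − Z^{ε_{K+n}}|` -/

section Device

variable {Y : Type*} [MeasurableSpace Y]

/-- **(3.10)–(3.11)**, the mechanism, PROVED for an arbitrary measure space: if two numbers `Z, Z′` are squeezed by the
SAME kind of small-field integrals, `I ≤ Z ≤ I + E`, `I′ ≤ Z′ ≤ I′ + E` with `I = ∫χe^{−S+c}`, `I′ = ∫χe^{−S′+c}` (Theorem
3.1 for `Z^{ε_K}` after `k` steps and for `Z^{ε_{K+n}}` after `k + n` steps), `χ` takes the values `0, 1`, and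
`χ|S − S′| ≤ δ` pointwise (Theorem 3.4), then *"|Z^{ε_K} − Z^{ε_{K+n}}| ≤ ∫(dA_k)(dφ_k)χ_k ·|exp[−S^{(k),1} + …] −
exp[−S^{(k+n),1} + …]| + exp[−p(L^kε_K)² + C|T|] (3.10)"* and, *"Using Theorem 3.4 and the bound |e^x − e^y| ≤
|x − y|(e^x + e^y)"*, `|Z − Z′| ≤ δ(Z + Z′) + E` (the first line of (3.11)).  Finiteness of the two small-field integrals
is the hypothesis `Integrable`. [cite: King1986, (3.10)–(3.11) p.656] -/
theorem abs_sub_le_of_smallField_bounds (μ : Measure Y) {χ S S' : Y → ℝ} {Z Z' c E δ : ℝ}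
    (hχ : ∀ x, χ x = 0 ∨ χ x = 1)
    (hI : Integrable (fun x => χ x * Real.exp (-(S x) + c)) μ)
    (hI' : Integrable (fun x => χ x * Real.exp (-(S' x) + c)) μ)
    (h33 : ∫ x, χ x * Real.exp (-(S x) + c) ∂μ ≤ Z)
    (h34 : Z ≤ (∫ x, χ x * Real.exp (-(S x) + c) ∂μ) + E)
    (h33' : ∫ x, χ x * Real.exp (-(S' x) + c) ∂μ ≤ Z')
    (h34' : Z' ≤ (∫ x, χ x * Real.exp (-(S' x) + c) ∂μ) + E)
    (h39 : ∀ x, χ x * |S x - S' x| ≤ δ) (hδ : 0 ≤ δ) :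
    |Z - Z'| ≤ δ * (Z + Z') + E := by
  set f : Y → ℝ := fun x => χ x * Real.exp (-(S x) + c) with hf
  set g : Y → ℝ := fun x => χ x * Real.exp (-(S' x) + c) with hg
  -- (3.10): |Z − Z′| ≤ |I − I′| + E
  have h310 : |Z - Z'| ≤ |(∫ x, f x ∂μ) - ∫ x, g x ∂μ| + E := by
    rw [abs_le]
    constructor
    · have := neg_abs_le ((∫ x, f x ∂μ) - ∫ x, g x ∂μ)
      linarith
    · have := le_abs_self ((∫ x, f x ∂μ) - ∫ x, g x ∂μ)
      linarith
  -- pointwise: |f − g| ≤ δ (f + g)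
  have hpt : ∀ x, |f x - g x| ≤ δ * (f x + g x) := by
    intro x
    rcases hχ x with h0 | h1
    · simp [hf, hg, h0]
    · have hx := h39 x
      rw [h1, one_mul] at hx
      simp only [hf, hg, h1, one_mul]
      have hexp := abs_exp_sub_exp_le (-(S x) + c) (-(S' x) + c)
      have hsub : |(-(S x) + c) - (-(S' x) + c)| = |S x - S' x| := by
        rw [show (-(S x) + c) - (-(S' x) + c) = -(S x - S' x) by ring, abs_neg]
      rw [hsub] at hexp
      have hpos : 0 ≤ Real.exp (-(S x) + c) + Real.exp (-(S' x) + c) := by positivity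
      calc |Real.exp (-(S x) + c) - Real.exp (-(S' x) + c)|
          ≤ |S x - S' x| * (Real.exp (-(S x) + c) + Real.exp (-(S' x) + c)) := hexp
        _ ≤ δ * (Real.exp (-(S x) + c) + Real.exp (-(S' x) + c)) :=
            mul_le_mul_of_nonneg_right hx hpos
  -- (3.11), first line: |I − I′| ≤ ∫|f − g| ≤ δ(I + I′) ≤ δ(Z + Z′)
  have hint : |(∫ x, f x ∂μ) - ∫ x, g x ∂μ| ≤ δ * ((∫ x, f x ∂μ) + ∫ x, g x ∂μ) := by
    rw [← integral_sub hI hI']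
    calc |∫ x, (f x - g x) ∂μ| ≤ ∫ x, |f x - g x| ∂μ := abs_integral_le_integral_abs
      _ ≤ ∫ x, δ * (f x + g x) ∂μ :=
          integral_mono (hI.sub hI').abs ((hI.add hI').const_mul δ) hpt
      _ = δ * ((∫ x, f x ∂μ) + ∫ x, g x ∂μ) := by
          rw [integral_const_mul, integral_add hI hI']
  have hZZ : δ * ((∫ x, f x ∂μ) + ∫ x, g x ∂μ) ≤ δ * (Z + Z') :=
    mul_le_mul_of_nonneg_left (by linarith) hδ
  linarith

/-- The bookkeeping of (3.11), second line, PROVED: with `δ = C·r·|T|` (Theorem 3.4, `r` the rate), `Z, Z′ ≤ e^{C₂|T|}`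
(ultra-violet stability) and `E ≤ s·e^{C′|T|}` (*"exp[−p(ε)²] ≤ ε^σ for ε small, since p ≥ 1"*, p. 657),
`δ(Z + Z′) + E ≤ (2C|T|e^{C₂|T|})·r + e^{C′|T|}·s`. [cite: King1986, (3.11) p.656–657] -/
theorem bound_311 {Z Z' E δ C r vol C₂ C' s : ℝ} (hδ : δ = C * r * vol) (hC : 0 ≤ C) (hr : 0 ≤ r) (hvol : 0 ≤ vol)
    (hZ : Z ≤ Real.exp (C₂ * vol)) (hZ' : Z' ≤ Real.exp (C₂ * vol)) (hE : E ≤ s * Real.exp (C' * vol)) :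
    δ * (Z + Z') + E ≤ (2 * C * vol * Real.exp (C₂ * vol)) * r + Real.exp (C' * vol) * s := by
  have hδ0 : 0 ≤ δ := by rw [hδ]; positivity
  have h1 : δ * (Z + Z') ≤ δ * (2 * Real.exp (C₂ * vol)) := mul_le_mul_of_nonneg_left (by linarith) hδ0
  rw [hδ] at h1 ⊢
  nlinarith

/-- p. 657 [PDF 9]: *"where we have used the ultra-violet stability bound and exp[−p(ε)²] ≤ ε^σ for ε small, since
p ≥ 1"* — PROVED in the explicit form: for `0 < ε ≤ 1`, `b₀ > 0`, `p ≥ 1`, `exp[−p(ε)²] ≤ ε^{b₀²}`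
(`p(ε)² ≥ b₀²(1 + log ε⁻¹) ≥ b₀² log ε⁻¹`). [cite: King1986, (3.11) p.657] -/
theorem exp_neg_pFn_sq_le {b₀ p ε : ℝ} (hb : 0 < b₀) (hp : 1 ≤ p) (hε : 0 < ε) (hε1 : ε ≤ 1) :
    Real.exp (-(Balaban1983to89.B2.pFn b₀ p ε) ^ 2) ≤ ε ^ (b₀ ^ 2) := by
  set u : ℝ := Real.log ε⁻¹ with hu
  have hu0 : 0 ≤ u := by
    rw [hu]; exact Real.log_nonneg (one_le_inv_iff₀.2 ⟨hε, hε1⟩)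
  have h1u : 1 ≤ 1 + u := by linarith
  -- (1 + u)^p ≥ 1 + u
  have hpow : 1 + u ≤ (1 + u) ^ p := by
    have := Real.rpow_le_rpow_of_exponent_le h1u hp
    rwa [Real.rpow_one] at this
  have hpFn : b₀ * (1 + u) ≤ Balaban1983to89.B2.pFn b₀ p ε := by
    rw [pFn_eq]; exact mul_le_mul_of_nonneg_left hpow hb.le
  have hsq : b₀ ^ 2 * u ≤ (Balaban1983to89.B2.pFn b₀ p ε) ^ 2 := by
    have h0 : 0 ≤ b₀ * (1 + u) := by positivity
    have h2 : (b₀ * (1 + u)) ^ 2 ≤ (Balaban1983to89.B2.pFn b₀ p ε) ^ 2 := pow_le_pow_left₀ h0 hpFn 2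
    nlinarith
  calc Real.exp (-(Balaban1983to89.B2.pFn b₀ p ε) ^ 2)
      ≤ Real.exp (-(b₀ ^ 2 * u)) := Real.exp_le_exp.2 (by linarith)
    _ = ε ^ (b₀ ^ 2) := by
        rw [hu, Real.log_inv, Real.rpow_def_of_pos hε]
        ring_nf

end Device

/-! ## §8 «Hence {Z^{ε_K}(T_{ε_K}, g, h)} is a Cauchy sequence and converges» — Theorem 2.1 (i) from Theorems 3.1 and 3.4, PROVED -/

/-- With `k = [2βK(2β+γ)^{−1}]` the number of remaining scales `K − k` grows linearly: `γK/(2β+γ) ≤ K − k`.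
[cite: King1986, (3.12) p.657] -/
theorem sub_kChoice_ge {β γ : ℝ} (hβ : 0 < β) (hγ : 0 < γ) (K : ℕ) :
    γ / (2 * β + γ) * K ≤ (K : ℝ) - kChoice β γ K := by
  have h := (exponents_at_kChoice (σ := 1) hβ hγ one_pos K).2
  have h1 : (1 : ℝ) * γ / (2 * β + γ) * K = γ / (2 * β + γ) * K := by ring
  rw [h1] at h
  linarith

namespace RGData

variable {X : ℕ → Type*} [∀ m, MeasurableSpace (X m)] (D : RGData X)

/-- **pp. 656–657, the proof of Theorem 2.1 (i), PROVED over the schema** — the QUANTITATIVE form (3.10)–(3.13): if the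
data satisfy Theorem 3.1 (3.3)–(3.4), Theorem 3.4 (3.9) and the ultra-violet stability bound, `χ_k ∈ {0, 1}`, the
small-field integrals are finite, `L > 1`, `b₀ > 0`, `p ≥ 1`, `|T| ≥ 0`, then there are `K₀` and a constant `B` such that
for every `K ≥ K₀` and every `n`,
`|Z^{ε_K} − Z^{ε_{K+n}}| ≤ B·(L^{β+γ}(L^{−βγK/(2β+γ)} + L^{−σγK/(2β+γ)})) + e^{C|T|}·L^{−b₀²γK/(2β+γ)}`
— (3.13) with `k = [2βK(2β+γ)^{−1}]` (3.12); the last term is the large-field remainder `exp[−p(L^kε_K)² + C|T|]` through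
`exp[−p(ε)²] ≤ ε^{b₀²}`. [cite: King1986, (3.10)–(3.13) pp.656–657] -/
theorem cauchy_bound_313 (hL : 1 < D.L) (hb : 0 < D.b₀) (hp : 1 ≤ D.p) (hvol : 0 ≤ D.vol)
    (hχ : ∀ m x, D.chi m x = 0 ∨ D.chi m x = 1)
    (hfin : ∀ (C σ : ℝ) (m k : ℕ),
      Integrable (fun x => D.chi m x * Real.exp (-(D.S m k x) + C * (eps D.L m) ^ σ * D.vol)) (D.μ m))
    (h31 : D.Thm31Printed) (h34 : D.Thm34Printed) (hUV : D.UVStable) :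
    ∃ (γ σ β b C₁ Bc : ℝ) (K₀ : ℕ), 0 < γ ∧ 0 < σ ∧ 0 < β ∧ 0 < b ∧ 0 ≤ Bc ∧ ∀ K : ℕ, K₀ ≤ K → ∀ n : ℕ,
      |D.Z K - D.Z (K + n)|
        ≤ Bc * ((D.L : ℝ) ^ (β + γ) * ((D.L : ℝ) ^ (-(β * γ / (2 * β + γ) * K))
              + (D.L : ℝ) ^ (-(σ * γ / (2 * β + γ) * K))))
          + Real.exp (C₁ * D.vol) * (D.L : ℝ) ^ (-(b * γ / (2 * β + γ) * K)) := by
  obtain ⟨J, σ₁, C₁, _hσ₁, h31⟩ := h31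
  obtain ⟨γ, σ, β, C, hγ, _hγ1, hσ, hβ, h34⟩ := h34
  obtain ⟨C₃, C₂, hUV⟩ := hUV
  have hL0 : 0 < D.L := by omega
  have hL1 : 1 ≤ D.L := hL.le
  have hLr : (1 : ℝ) < D.L := by exact_mod_cast hL
  have hLr0 : (0 : ℝ) < D.L := by linarith
  have hden : 0 < 2 * β + γ := by linarith
  -- `K₀`: beyond it, `m = K − k ≥ J`
  set K₀ : ℕ := ⌈(J : ℝ) * (2 * β + γ) / γ⌉₊ with hK₀
  refine ⟨γ, σ, β, D.b₀ ^ 2, C₁, 2 * |C| * D.vol * Real.exp (C₂ * D.vol), K₀, hγ, hσ, hβ, by positivity,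
    by positivity, ?_⟩
  intro K hK n
  -- the choice (3.12)
  set k : ℕ := kChoice β γ K with hk
  have hkK : k ≤ K := kChoice_le hβ hγ K
  set m : ℕ := K - k with hm
  have hmK : m + k = K := Nat.sub_add_cancel hkK
  have hmr : (m : ℝ) = (K : ℝ) - k := by rw [hm]; exact Nat.cast_sub hkK
  have hmJ : J ≤ m := by
    have h1 : γ / (2 * β + γ) * K ≤ (m : ℝ) := by rw [hmr]; exact sub_kChoice_ge hβ hγ K
    have h2 : (J : ℝ) * (2 * β + γ) / γ ≤ K := le_trans (Nat.le_ceil _) (by exact_mod_cast hK)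
    have h3 : (J : ℝ) ≤ γ / (2 * β + γ) * K := by
      rw [div_le_iff₀ hγ] at h2
      rw [div_mul_eq_mul_div, le_div_iff₀ hden]
      linarith
    exact_mod_cast h3.trans h1
  -- Theorem 3.1 for `Z^{ε_K}` (k steps) and `Z^{ε_{K+n}}` (k + n steps)
  obtain ⟨h33, h34a⟩ := h31 m k hmJ
  obtain ⟨h33', h34a'⟩ := h31 m (k + n) hmJ
  rw [hmK] at h33 h34a
  rw [show m + (k + n) = K + n by omega] at h33' h34a'
  -- Theorem 3.4 in the form `χ|S − S′| ≤ δ`, `δ = |C|·rate·|T| ≥ 0`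
  set rate : ℝ := (D.L : ℝ) ^ (-(γ * k)) * (eps D.L m) ^ (-β) + (eps D.L m) ^ σ with hrate
  have hrate0 : 0 ≤ rate := by
    have h1 : 0 < eps D.L m := eps_pos hL0 m
    positivity
  have h39 : ∀ x : X m, D.chi m x * |D.S m k x - D.S m (k + n) x| ≤ |C| * rate * D.vol := by
    intro x
    refine (h34 m k n x).trans ?_
    have : C * rate * D.vol ≤ |C| * rate * D.vol := by
      have := le_abs_self C
      have h2 : 0 ≤ rate * D.vol := by positivity
      nlinarith
    simpa [hrate, mul_assoc] using this
  -- (3.10)–(3.11), first line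
  have hmain := abs_sub_le_of_smallField_bounds (D.μ m) (hχ m) (hfin C₁ σ₁ m k) (hfin C₁ σ₁ m (k + n))
    h33 h34a h33' h34a' h39 (by positivity)
  -- the large-field remainder: `exp[−p(L^kε_K)² + C₁|T|] ≤ (L^kε_K)^{b₀²} e^{C₁|T|}`
  have hE : D.largeFieldRemainder C₁ m ≤ (eps D.L m) ^ (D.b₀ ^ 2) * Real.exp (C₁ * D.vol) := by
    unfold largeFieldRemainder
    rw [Real.exp_add]
    exact mul_le_mul_of_nonneg_right (exp_neg_pFn_sq_le hb hp (eps_pos hL0 m) (eps_le_one hL1 m))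
      (Real.exp_pos _).le
  -- (3.11), second line
  have h311 := bound_311 (C := |C|) (r := rate) (vol := D.vol) (C₂ := C₂) (C' := C₁) (s := (eps D.L m) ^ (D.b₀ ^ 2))
    rfl (abs_nonneg C) hrate0 hvol (hUV K).2 (hUV (K + n)).2 hE
  -- (3.13): the rate at `k = [2βK(2β+γ)^{−1}]`
  have hrate313 : rate ≤ (D.L : ℝ) ^ (β + γ) * ((D.L : ℝ) ^ (-(β * γ / (2 * β + γ) * K))
      + (D.L : ℝ) ^ (-(σ * γ / (2 * β + γ) * K))) := by
    have h1 : (eps D.L m) ^ (-β) = (D.L : ℝ) ^ (β * ((K : ℝ) - k)) := by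
      rw [eps_rpow hL0, hmr]; ring_nf
    have h2 : (eps D.L m) ^ σ = (D.L : ℝ) ^ (-(σ * ((K : ℝ) - k))) := by
      rw [eps_rpow hL0, hmr]
    rw [hrate, h1, h2]
    exact rate_at_kChoice hLr hβ hγ hσ K
  have hs : (eps D.L m) ^ (D.b₀ ^ 2) ≤ (D.L : ℝ) ^ (-(D.b₀ ^ 2 * γ / (2 * β + γ) * K)) := by
    rw [eps_rpow hL0, hmr]
    have h := (exponents_at_kChoice (σ := D.b₀ ^ 2) hβ hγ (by positivity) K).2
    exact Real.rpow_le_rpow_of_exponent_le hLr.le h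
  -- assemble
  have hA : 2 * |C| * D.vol * Real.exp (C₂ * D.vol) * rate
      ≤ 2 * |C| * D.vol * Real.exp (C₂ * D.vol) * ((D.L : ℝ) ^ (β + γ)
          * ((D.L : ℝ) ^ (-(β * γ / (2 * β + γ) * K)) + (D.L : ℝ) ^ (-(σ * γ / (2 * β + γ) * K)))) :=
    mul_le_mul_of_nonneg_left hrate313 (by positivity)
  have hB : Real.exp (C₁ * D.vol) * (eps D.L m) ^ (D.b₀ ^ 2)
      ≤ Real.exp (C₁ * D.vol) * (D.L : ℝ) ^ (-(D.b₀ ^ 2 * γ / (2 * β + γ) * K)) :=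
    mul_le_mul_of_nonneg_left hs (Real.exp_pos _).le
  linarith

/-- **THEOREM 2.1 (i) FROM THEOREMS 3.1 AND 3.4, PROVED over the schema** (p. 657: *"Hence {Z^{ε_K}(T_{ε_K}, g, h)} is a
Cauchy sequence and converges to a unique limit as K → ∞. The uniform bound in Theorem 2.1 is just the statement of
ultra-violet stability."*): under the hypotheses of `cauchy_bound_313` the sequence `K ↦ Z^{ε_K}(T_{ε_K}, g, h)` converges.
[cite: King1986, Thm 2.1 (2.22) p.654, (3.10)–(3.13) pp.656–657] -/
theorem hasContinuumLimit_of_thm31_thm34 (hL : 1 < D.L) (hb : 0 < D.b₀) (hp : 1 ≤ D.p) (hvol : 0 ≤ D.vol)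
    (hχ : ∀ m x, D.chi m x = 0 ∨ D.chi m x = 1)
    (hfin : ∀ (C σ : ℝ) (m k : ℕ),
      Integrable (fun x => D.chi m x * Real.exp (-(D.S m k x) + C * (eps D.L m) ^ σ * D.vol)) (D.μ m))
    (h31 : D.Thm31Printed) (h34 : D.Thm34Printed) (hUV : D.UVStable) :
    HasContinuumLimit D.Z := by
  obtain ⟨γ, σ, β, b, C₁, Bc, K₀, hγ, hσ, hβ, hb0, hBc, hbound⟩ :=
    D.cauchy_bound_313 hL hb hp hvol hχ hfin h31 h34 hUV
  have hLr : (1 : ℝ) < D.L := by exact_mod_cast hL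
  have hLr0 : (0 : ℝ) < D.L := by linarith
  have hden : 0 < 2 * β + γ := by linarith
  -- the bound sequence and its limit 0
  set B : ℕ → ℝ := fun K =>
    Bc * ((D.L : ℝ) ^ (β + γ) * ((D.L : ℝ) ^ (-(β * γ / (2 * β + γ) * K))
        + (D.L : ℝ) ^ (-(σ * γ / (2 * β + γ) * K))))
      + Real.exp (C₁ * D.vol) * (D.L : ℝ) ^ (-(b * γ / (2 * β + γ) * K)) with hBdef
  have hB0 : Tendsto B atTop (𝓝 0) := by
    have h1 := tendsto_rate313 hLr hβ hγ hσ (Bc * (D.L : ℝ) ^ (β + γ))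
    have hb' : 0 < b * γ / (2 * β + γ) := by positivity
    have h2 : Tendsto (fun K : ℕ => ((D.L : ℝ) ^ (-(b * γ / (2 * β + γ)))) ^ K) atTop (𝓝 0) :=
      tendsto_pow_atTop_nhds_zero_of_lt_one (rpow_neg_lt_one hLr hb').1 (rpow_neg_lt_one hLr hb').2
    have h3 := h1.add (h2.const_mul (Real.exp (C₁ * D.vol)))
    simp only [mul_zero, add_zero] at h3
    refine h3.congr' (Eventually.of_forall fun K => ?_)
    simp only [hBdef, rpow_neg_mul_natCast hLr0]
    ring
  -- Cauchy
  have hC : CauchySeq D.Z := by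
    refine Metric.cauchySeq_iff'.2 fun ε hε => ?_
    obtain ⟨N₁, hN₁⟩ := Metric.tendsto_atTop.1 hB0 ε hε
    refine ⟨max N₁ K₀, fun n hn => ?_⟩
    have hN : K₀ ≤ max N₁ K₀ := le_max_right _ _
    obtain ⟨j, rfl⟩ := Nat.exists_eq_add_of_le hn
    have h1 := hbound (max N₁ K₀) hN j
    have h2 := hN₁ (max N₁ K₀) (le_max_left _ _)
    rw [Real.dist_eq, sub_zero] at h2
    rw [Real.dist_eq, abs_sub_comm]
    exact lt_of_le_of_lt h1 (lt_of_le_of_lt (le_abs_self _) h2)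
  exact cauchySeq_tendsto_of_complete hC

end RGData

end Literature.MathematicalPhysics.QuantumFieldTheory.King1986.ContinuumLimit

end
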